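import Summits.QuantumFields.YangMills.Theorems.UnitScaleTiltProp7FramedSecondDifference
import Summits.QuantumFields.YangMills.Theorems.UnitScaleTiltProp7ConjFrameTransport
import HarnessLib

/-!
# Route `UnitScaleTilt`, crux K1 «MinimiserStabilityRegPr» (stmt-QuantumFields-19200), route-R E′ path (α′), S2 ∕ (E1-b) at the CURVED background — the NEAR-FIELD TRANSPLANT, brick 1:
# THE COVARIANT LAPLACIAN OF A FRAME-TRANSPORTED «SCALAR × CONSTANT MATRIX» FIELD `z ↦ φ(z)•R(Fr z)Y` IS THE FLAT LAPLACIAN OF `φ` TIMES THE TRANSPORTED CONSTANT, UP TO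
# `2τ₁·(first differences of φ) + (2τ₂ + 4τ₁²)·|φ|` — the letter by which the flat near-field pre-solutions of px22's (A) chain are transplanted into a (3.35) frame (LOCATE-PCOV2 v1.2 §5)

Cell `ym3-torus`, extra width seat `ym-routeR-w6` (gen 6).  THEOREMS ONLY (0 `def`, 0 `sorry`); `--supports stmt-QuantumFields-19200`, count-neutral.  YM₃ on T³ is a ladder rung (R3),
not the Clay problem; nothing here claims a stub, the crux, d = 4 or the mass gap.

WHAT IS PROVED (ns `…Theorems.Prop7FramedScalarMatrix`; abstract carrier `S ι T`, background `V` (resp. `U` with a frame `Fr`), real scalar field `φ : S → ℝ`, constant `Y : 𝔸`).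
* §1 (any ring) `covD_smul_const`, `covLaplace_smul_const`, `covLaplace_sub_flat` — exact formulas for `D_V(φ•Y)`, `Δ_V(φ•Y) − (Δφ)•Y` and, for a GENERAL field `F`, `Δ_V F − Δ_flat F`
  (`Δ_V := divB ∘ covD`, the positive Laplacian; `Δ_flat F(x) = Σ_μ((F x − F(T_μx)) + (F x − F(T_μ⁻¹x)))`).
* §2 (normed ring, bi-contractive units) ★ `norm_R_add_R_inv_sub_two_le` — the LONGITUDINAL PAIR: `‖(R(h)Y − Y) + (R(h′)⁻¹Y − Y)‖ ≤
  (2‖h − h′‖ + 4τ₁²)‖Y‖` for `‖h − 1‖, ‖h′ − 1‖ ≤ τ₁` (via ✓ `Prop7ConjFrameTransport.R_sub_self_eq_comm_mul` ∕ `R_inv_sub_self_eq_neg_mul_comm`: `R(h)Y − Y = [h−1, Y]h⁻¹`, `R(h′)⁻¹Y − Y = −h′⁻¹[h′−1, Y]`).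
* §3 ★★ `norm_covLaplace_smul_const_sub_le` — `‖Δ_V(φ•Y)(x) − (Δφ)(x)•Y‖ ≤ Σ_μ[(2τ₂+4τ₁²)|φ x| + 2τ₁|φ(T_μx) − φ x| + 2τ₁|φ(T_μ⁻¹x) − φ x|]·‖Y‖` under the rows `‖V_μ(x) − 1‖, ‖V_μ(T_μ⁻¹x) − 1‖ ≤ τ₁`,
  `‖V_μ(x) − V_μ(T_μ⁻¹x)‖ ≤ τ₂` (the LONGITUDINAL difference only — ✓ `Prop7ConjFrameReg335.frame_rows_of_reg335Cube`'s exported row), ★★ `norm_covLaplace_sub_flat_le` (the same for a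
  general field `F`, with `‖F x‖`, `‖F(T_μ^{±1}x) − F x‖`), and ★ `norm_covD_smul_const_sub_le` (first order).
* §4 ★★★ `norm_covLaplace_framedConst_sub_le` — FRAMED: `‖Δ_U(φ•R(Fr ·)Y)(x) − (Δφ)(x)•R(Fr x)Y‖ ≤` the same bound with the framed links `h_μ(z) = Fr(z)⁻¹U_μ(z)Fr(T_μz)` (✓p666119 gauge
  covariance + bi-contractivity), ★★★ `norm_covLaplace_framed_sub_flat_le` (general `F`: `‖Δ_U(R(Fr ·)F)(x) − R(Fr x)Δ_flat F(x)‖`), ★★ `norm_covD_framedConst_sub_le`, ★★ `norm_covD_framed_sub_fdiff_le`.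
HONEST SCOPE.  Pointwise algebra; frames∕rows displayed; the transplant bookkeeping (cutoffs, generations, the flat convolution letters) is elsewhere (LOCATE v1.2 §5).

References: T. Bałaban, CMP 99 (1985) 389–434 [Balaban1985BackgroundPropagators] ((3.3), (3.8) pp.390–392, (3.28) p.395, (3.35) p.396).
-/

set_option autoImplicit false

noncomputable section

namespace Summit.QuantumFields.YangMills.Theorems.Prop7FramedScalarMatrix

open Literature.MathematicalPhysics.QuantumFieldTheory.Balaban1983to89
open B9Eq39Adjoint (R R_def R_sub R_one covD covDstar divB)
open B11Eq135Weitzenbock (norm_R_sub_self_le)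
open B9Eq310Hermitian (norm_R_le)
open B9Thm310CommutatorDataOfPlaquettes (bicontr_mul bicontr_inv)
open Summit.QuantumFields.YangMills.Theorems.Prop7FramedSecondDifference (R_inv_frame_covD)
open Summit.QuantumFields.YangMills.Theorems.Prop7ConjFrameTransport (R_sub_self_eq_comm_mul R_inv_sub_self_eq_neg_mul_comm)

/-! ## §1 Exact formulas (any ring, real scalars) -/

section RingLevel

variable {𝔸 : Type*} [Ring 𝔸] [Algebra ℝ 𝔸] {S : Type*} {ι : Type*} (T : ι → Equiv.Perm S) (V : ι → S → 𝔸ˣ)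

/-- `D_V(φ•Y)(x) = (φ(T_μx) − φ x)•Y + φ(T_μx)•(R(V_μ x)Y − Y)`. [cite: Balaban1985BackgroundPropagators, (3.3) p.390] -/
theorem covD_smul_const (φ : S → ℝ) (Y : 𝔸) (μ : ι) (x : S) :
    covD T V μ (fun z => φ z • Y) x = (φ (T μ x) - φ x) • Y + φ (T μ x) • (R (V μ x) Y - Y) := by
  simp only [covD, B9Eq39Adjoint.R_smul, smul_sub, sub_smul]
  abel

variable [Fintype ι]

/-- `Δ_V(φ•Y)(x) − (Δφ)(x)•Y = −Σ_μ[φ(T_μx)•(R(V_μ x)Y − Y) + φ(T_μ⁻¹x)•(R(V_μ(T_μ⁻¹x))⁻¹Y − Y)]` with the positive flat Laplacian `(Δφ)(x) = Σ_μ(2φ x − φ(T_μx) − φ(T_μ⁻¹x))`.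
[cite: Balaban1985BackgroundPropagators, (3.8) p.392] -/
theorem covLaplace_smul_const (φ : S → ℝ) (Y : 𝔸) (x : S) :
    divB T V (fun μ => covD T V μ (fun z => φ z • Y)) x - (∑ μ, (2 * φ x - φ (T μ x) - φ ((T μ).symm x))) • Y
      = -∑ μ, (φ (T μ x) • (R (V μ x) Y - Y) + φ ((T μ).symm x) • (R (V μ ((T μ).symm x))⁻¹ Y - Y)) := by
  have hy : ∀ μ, T μ ((T μ).symm x) = x := fun μ => Equiv.apply_symm_apply _ _
  simp only [divB, covDstar, covD, hy, B9Eq39Adjoint.R_smul, B9Eq39Adjoint.R_sub, B9Eq39Adjoint.R_inv_R, Finset.sum_smul, ← Finset.sum_neg_distrib,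
    ← Finset.sum_sub_distrib]
  refine Finset.sum_congr rfl fun μ _ => ?_
  simp only [smul_sub, sub_smul, mul_smul, two_smul]
  abel

omit [Algebra ℝ 𝔸] in
/-- GENERAL FIELD: `Δ_V F(x) − Δ_flat F(x) = −Σ_μ[(R(V_μ x)F(T_μx) − F(T_μx)) + (R(V_μ(T_μ⁻¹x))⁻¹F(T_μ⁻¹x) − F(T_μ⁻¹x))]`, the positive flat Laplacian written numeral-free as
`Δ_flat F(x) = Σ_μ((F x − F(T_μx)) + (F x − F(T_μ⁻¹x)))`. [cite: Balaban1985BackgroundPropagators, (3.8) p.392] -/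
theorem covLaplace_sub_flat (F : S → 𝔸) (x : S) :
    divB T V (fun μ => covD T V μ F) x - ∑ μ, ((F x - F (T μ x)) + (F x - F ((T μ).symm x)))
      = -∑ μ, ((R (V μ x) (F (T μ x)) - F (T μ x)) + (R (V μ ((T μ).symm x))⁻¹ (F ((T μ).symm x)) - F ((T μ).symm x))) := by
  have hy : ∀ μ, T μ ((T μ).symm x) = x := fun μ => Equiv.apply_symm_apply _ _
  simp only [divB, covDstar, covD, hy, B9Eq39Adjoint.R_sub, B9Eq39Adjoint.R_inv_R, ← Finset.sum_neg_distrib, ← Finset.sum_sub_distrib]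
  refine Finset.sum_congr rfl fun μ _ => ?_
  abel

end RingLevel

/-! ## §2 The longitudinal pair of transports -/

section NormLevel

variable {𝔸 : Type} [NormedRing 𝔸] [NormedAlgebra ℝ 𝔸]

omit [NormedAlgebra ℝ 𝔸] in
/-- ★ **THE LONGITUDINAL PAIR**: for bi-contractive `h, h′` with `‖h − 1‖, ‖h′ − 1‖ ≤ τ₁` and `‖h − h′‖ ≤ τ₂`: `‖(R(h)Y − Y) + (R(h′)⁻¹Y − Y)‖ ≤ (2τ₂ + 4τ₁²)‖Y‖` (the first-order
commutators cancel up to `[h − h′, Y]`). [cite: Balaban1985BackgroundPropagators, (3.35) p.396] -/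
theorem norm_R_add_R_inv_sub_two_le {h h' : 𝔸ˣ} (hh : ‖(h : 𝔸)‖ ≤ 1 ∧ ‖((h⁻¹ : 𝔸ˣ) : 𝔸)‖ ≤ 1) (hh' : ‖(h' : 𝔸)‖ ≤ 1 ∧ ‖((h'⁻¹ : 𝔸ˣ) : 𝔸)‖ ≤ 1)
    {τ₁ τ₂ : ℝ} (h1 : ‖(h : 𝔸) - 1‖ ≤ τ₁) (h1' : ‖(h' : 𝔸) - 1‖ ≤ τ₁) (h2 : ‖(h : 𝔸) - h'‖ ≤ τ₂) (Y : 𝔸) :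
    ‖(R h Y - Y) + (R h'⁻¹ Y - Y)‖ ≤ (2 * τ₂ + 4 * τ₁ ^ 2) * ‖Y‖ := by
  have hτ₁ : 0 ≤ τ₁ := (norm_nonneg _).trans h1
  have e0 := R_sub_self_eq_comm_mul h Y
  have e0' := R_inv_sub_self_eq_neg_mul_comm h' Y
  have hu : (h : 𝔸) * ((h⁻¹ : 𝔸ˣ) : 𝔸) = 1 := Units.mul_inv h
  have hu' : ((h'⁻¹ : 𝔸ˣ) : 𝔸) * (h' : 𝔸) = 1 := Units.inv_mul h'
  set a : 𝔸 := (h : 𝔸) - 1 with ha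
  set a' : 𝔸 := (h' : 𝔸) - 1 with ha'
  -- exact decomposition (uses `h·h⁻¹ = 1 = h′⁻¹·h′` through `hu`, `hu'`)
  have e : (R h Y - Y) + (R h'⁻¹ Y - Y)
      = ((a - a') * Y - Y * (a - a')) * ((h⁻¹ : 𝔸ˣ) : 𝔸)
        + ((a' * Y - Y * a') * (((h⁻¹ : 𝔸ˣ) : 𝔸) - 1) + (1 - ((h'⁻¹ : 𝔸ˣ) : 𝔸)) * (a' * Y - Y * a')) := by
    rw [e0, e0']
    have k1 : a' * Y * ((h⁻¹ : 𝔸ˣ) : 𝔸) = a' * Y * ((h⁻¹ : 𝔸ˣ) : 𝔸) * (((h'⁻¹ : 𝔸ˣ) : 𝔸) * (h' : 𝔸)) := by rw [hu', mul_one]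
    have k2 : Y * a' * ((h⁻¹ : 𝔸ˣ) : 𝔸) = Y * a' * ((h⁻¹ : 𝔸ˣ) : 𝔸) * (((h'⁻¹ : 𝔸ˣ) : 𝔸) * (h' : 𝔸)) := by rw [hu', mul_one]
    -- it is a ring identity in the atoms once `a′ = h′ − 1` is remembered: expand
    rw [ha']
    noncomm_ring
  rw [e]
  have haa' : ‖a - a'‖ ≤ τ₂ := by rw [ha, ha', sub_sub_sub_cancel_right]; exact h2
  have hcomm : ∀ b : 𝔸, ‖b * Y - Y * b‖ ≤ 2 * ‖b‖ * ‖Y‖ := fun b => by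
    calc ‖b * Y - Y * b‖ ≤ ‖b * Y‖ + ‖Y * b‖ := norm_sub_le _ _
      _ ≤ ‖b‖ * ‖Y‖ + ‖Y‖ * ‖b‖ := add_le_add (norm_mul_le _ _) (norm_mul_le _ _)
      _ = 2 * ‖b‖ * ‖Y‖ := by ring
  have hinv1 : ‖((h⁻¹ : 𝔸ˣ) : 𝔸) - 1‖ ≤ τ₁ := by
    have e1 : ((h⁻¹ : 𝔸ˣ) : 𝔸) - 1 = ((h⁻¹ : 𝔸ˣ) : 𝔸) * (1 - (h : 𝔸)) := by rw [mul_sub, mul_one, Units.inv_mul]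
    rw [e1]
    calc _ ≤ ‖((h⁻¹ : 𝔸ˣ) : 𝔸)‖ * ‖1 - (h : 𝔸)‖ := norm_mul_le _ _
      _ ≤ 1 * τ₁ := by gcongr; exacts [hh.2, by rw [norm_sub_rev]; exact h1]
      _ = τ₁ := one_mul _
  have hinv1' : ‖1 - ((h'⁻¹ : 𝔸ˣ) : 𝔸)‖ ≤ τ₁ := by
    have e1 : 1 - ((h'⁻¹ : 𝔸ˣ) : 𝔸) = ((h'⁻¹ : 𝔸ˣ) : 𝔸) * ((h' : 𝔸) - 1) := by rw [mul_sub, mul_one, Units.inv_mul]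
    rw [e1]
    calc _ ≤ ‖((h'⁻¹ : 𝔸ˣ) : 𝔸)‖ * ‖(h' : 𝔸) - 1‖ := norm_mul_le _ _
      _ ≤ 1 * τ₁ := by gcongr; exact hh'.2
      _ = τ₁ := one_mul _
  have T1 : ‖((a - a') * Y - Y * (a - a')) * ((h⁻¹ : 𝔸ˣ) : 𝔸)‖ ≤ 2 * τ₂ * ‖Y‖ := by
    calc _ ≤ ‖(a - a') * Y - Y * (a - a')‖ * ‖((h⁻¹ : 𝔸ˣ) : 𝔸)‖ := norm_mul_le _ _
      _ ≤ (2 * ‖a - a'‖ * ‖Y‖) * 1 := mul_le_mul (hcomm _) hh.2 (norm_nonneg _) (by positivity)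
      _ ≤ (2 * τ₂ * ‖Y‖) * 1 := by gcongr
      _ = 2 * τ₂ * ‖Y‖ := mul_one _
  have T2 : ‖(a' * Y - Y * a') * (((h⁻¹ : 𝔸ˣ) : 𝔸) - 1)‖ ≤ 2 * τ₁ * ‖Y‖ * τ₁ := by
    calc _ ≤ ‖a' * Y - Y * a'‖ * ‖((h⁻¹ : 𝔸ˣ) : 𝔸) - 1‖ := norm_mul_le _ _
      _ ≤ (2 * ‖a'‖ * ‖Y‖) * τ₁ := mul_le_mul (hcomm _) hinv1 (norm_nonneg _) (by positivity)
      _ ≤ (2 * τ₁ * ‖Y‖) * τ₁ := by gcongr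
  have T3 : ‖(1 - ((h'⁻¹ : 𝔸ˣ) : 𝔸)) * (a' * Y - Y * a')‖ ≤ τ₁ * (2 * τ₁ * ‖Y‖) := by
    calc _ ≤ ‖1 - ((h'⁻¹ : 𝔸ˣ) : 𝔸)‖ * ‖a' * Y - Y * a'‖ := norm_mul_le _ _
      _ ≤ τ₁ * (2 * ‖a'‖ * ‖Y‖) := mul_le_mul hinv1' (hcomm _) (norm_nonneg _) hτ₁
      _ ≤ τ₁ * (2 * τ₁ * ‖Y‖) := by gcongr
  calc _ ≤ ‖((a - a') * Y - Y * (a - a')) * ((h⁻¹ : 𝔸ˣ) : 𝔸)‖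
        + ‖(a' * Y - Y * a') * (((h⁻¹ : 𝔸ˣ) : 𝔸) - 1) + (1 - ((h'⁻¹ : 𝔸ˣ) : 𝔸)) * (a' * Y - Y * a')‖ := norm_add_le _ _
    _ ≤ 2 * τ₂ * ‖Y‖ + (2 * τ₁ * ‖Y‖ * τ₁ + τ₁ * (2 * τ₁ * ‖Y‖)) := add_le_add T1 ((norm_add_le _ _).trans (add_le_add T2 T3))
    _ = (2 * τ₂ + 4 * τ₁ ^ 2) * ‖Y‖ := by ring

end NormLevel

/-! ## §3 ★★ The comparison at a background near `1` -/

section Compare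

variable {𝔸 : Type} [NormedRing 𝔸] [NormedAlgebra ℝ 𝔸] {S : Type*} {ι : Type*} [Fintype ι] (T : ι → Equiv.Perm S) (V : ι → S → 𝔸ˣ)

omit [Fintype ι] in
/-- ★ **FIRST ORDER**: `‖D_V(φ•Y)(x) − (φ(T_μx) − φ x)•Y‖ ≤ 2‖V_μ(x) − 1‖·|φ(T_μx)|·‖Y‖`. [cite: Balaban1985BackgroundPropagators, (3.3) p.390] -/
theorem norm_covD_smul_const_sub_le (hV : ∀ (κ : ι) (y : S), ‖(V κ y : 𝔸)‖ ≤ 1 ∧ ‖(((V κ y)⁻¹ : 𝔸ˣ) : 𝔸)‖ ≤ 1)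
    (φ : S → ℝ) (Y : 𝔸) (μ : ι) (x : S) :
    ‖covD T V μ (fun z => φ z • Y) x - (φ (T μ x) - φ x) • Y‖ ≤ 2 * ‖((V μ x : 𝔸ˣ) : 𝔸) - 1‖ * (|φ (T μ x)| * ‖Y‖) := by
  rw [covD_smul_const, add_sub_cancel_left, norm_smul, Real.norm_eq_abs]
  have h := norm_R_sub_self_le (hV μ x).2 Y
  calc |φ (T μ x)| * ‖R (V μ x) Y - Y‖ ≤ |φ (T μ x)| * (2 * ‖((V μ x : 𝔸ˣ) : 𝔸) - 1‖ * ‖Y‖) := mul_le_mul_of_nonneg_left h (abs_nonneg _)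
    _ = _ := by ring

/-- ★★ **SECOND ORDER**: `‖Δ_V(φ•Y)(x) − (Δφ)(x)•Y‖ ≤ Σ_μ[(2τ₂+4τ₁²)|φ x| + 2τ₁|φ(T_μx) − φ x| + 2τ₁|φ(T_μ⁻¹x) − φ x|]·‖Y‖` under the size rows at `x`, `T_μ⁻¹x` and the LONGITUDINAL
difference row `‖V_μ(x) − V_μ(T_μ⁻¹x)‖ ≤ τ₂`. [cite: Balaban1985BackgroundPropagators, (3.8) p.392, (3.35) p.396] -/
theorem norm_covLaplace_smul_const_sub_le (hV : ∀ (κ : ι) (y : S), ‖(V κ y : 𝔸)‖ ≤ 1 ∧ ‖(((V κ y)⁻¹ : 𝔸ˣ) : 𝔸)‖ ≤ 1)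
    (φ : S → ℝ) (Y : 𝔸) (x : S) {τ₁ τ₂ : ℝ}
    (h1 : ∀ μ, ‖((V μ x : 𝔸ˣ) : 𝔸) - 1‖ ≤ τ₁) (h1' : ∀ μ, ‖((V μ ((T μ).symm x) : 𝔸ˣ) : 𝔸) - 1‖ ≤ τ₁)
    (h2 : ∀ μ, ‖((V μ x : 𝔸ˣ) : 𝔸) - (V μ ((T μ).symm x) : 𝔸ˣ)‖ ≤ τ₂) :
    ‖divB T V (fun μ => covD T V μ (fun z => φ z • Y)) x - (∑ μ, (2 * φ x - φ (T μ x) - φ ((T μ).symm x))) • Y‖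
      ≤ ∑ μ, ((2 * τ₂ + 4 * τ₁ ^ 2) * |φ x| + 2 * τ₁ * |φ (T μ x) - φ x| + 2 * τ₁ * |φ ((T μ).symm x) - φ x|) * ‖Y‖ := by
  rw [covLaplace_smul_const, norm_neg]
  refine (norm_sum_le _ _).trans (Finset.sum_le_sum fun μ _ => ?_)
  have hτ₁ : 0 ≤ τ₁ := (norm_nonneg _).trans (h1 μ)
  -- regroup: `φ₊•A + φ₋•B = φ•(A + B) + (φ₊ − φ)•A + (φ₋ − φ)•B`
  set A := R (V μ x) Y - Y with hA
  set B := R (V μ ((T μ).symm x))⁻¹ Y - Y with hB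
  have e : φ (T μ x) • A + φ ((T μ).symm x) • B = φ x • (A + B) + (φ (T μ x) - φ x) • A + (φ ((T μ).symm x) - φ x) • B := by
    simp only [smul_add, sub_smul]; abel
  rw [e]
  have nA : ‖A‖ ≤ 2 * τ₁ * ‖Y‖ := (norm_R_sub_self_le (hV μ x).2 Y).trans (by gcongr; exact h1 μ)
  have nB : ‖B‖ ≤ 2 * τ₁ * ‖Y‖ := by
    have h := norm_R_sub_self_le (bicontr_inv (hV μ ((T μ).symm x))).2 Y
    refine h.trans ?_
    have hinv : ‖(((V μ ((T μ).symm x))⁻¹ : 𝔸ˣ) : 𝔸) - 1‖ ≤ τ₁ := by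
      have e1 : (((V μ ((T μ).symm x))⁻¹ : 𝔸ˣ) : 𝔸) - 1 = (((V μ ((T μ).symm x))⁻¹ : 𝔸ˣ) : 𝔸) * (1 - (V μ ((T μ).symm x) : 𝔸)) := by
        rw [mul_sub, mul_one, Units.inv_mul]
      rw [e1]
      calc _ ≤ ‖(((V μ ((T μ).symm x))⁻¹ : 𝔸ˣ) : 𝔸)‖ * ‖1 - (V μ ((T μ).symm x) : 𝔸)‖ := norm_mul_le _ _
        _ ≤ 1 * τ₁ := by gcongr; exacts [(hV μ _).2, by rw [norm_sub_rev]; exact h1' μ]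
        _ = τ₁ := one_mul _
    gcongr
  have nAB : ‖A + B‖ ≤ (2 * τ₂ + 4 * τ₁ ^ 2) * ‖Y‖ := norm_R_add_R_inv_sub_two_le (hV μ x) (hV μ ((T μ).symm x)) (h1 μ) (h1' μ) (h2 μ) Y
  calc ‖φ x • (A + B) + (φ (T μ x) - φ x) • A + (φ ((T μ).symm x) - φ x) • B‖
      ≤ ‖φ x • (A + B)‖ + ‖(φ (T μ x) - φ x) • A‖ + ‖(φ ((T μ).symm x) - φ x) • B‖ := norm_add₃_le
    _ = |φ x| * ‖A + B‖ + |φ (T μ x) - φ x| * ‖A‖ + |φ ((T μ).symm x) - φ x| * ‖B‖ := by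
        simp only [norm_smul, Real.norm_eq_abs]
    _ ≤ |φ x| * ((2 * τ₂ + 4 * τ₁ ^ 2) * ‖Y‖) + |φ (T μ x) - φ x| * (2 * τ₁ * ‖Y‖) + |φ ((T μ).symm x) - φ x| * (2 * τ₁ * ‖Y‖) := by
        gcongr
    _ = _ := by ring

omit [NormedAlgebra ℝ 𝔸] in
/-- ★★ **SECOND ORDER, GENERAL FIELD**: `‖Δ_V F(x) − Δ_flat F(x)‖ ≤ Σ_μ[(2τ₂+4τ₁²)‖F x‖ + 2τ₁‖F(T_μx) − F x‖ + 2τ₁‖F(T_μ⁻¹x) − F x‖]` under the size rows at `x`, `T_μ⁻¹x` and the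
LONGITUDINAL difference row (matrix-valued densities of the second transplant generation are fed through this one). [cite: Balaban1985BackgroundPropagators, (3.8) p.392, (3.35) p.396] -/
theorem norm_covLaplace_sub_flat_le (hV : ∀ (κ : ι) (y : S), ‖(V κ y : 𝔸)‖ ≤ 1 ∧ ‖(((V κ y)⁻¹ : 𝔸ˣ) : 𝔸)‖ ≤ 1)
    (F : S → 𝔸) (x : S) {τ₁ τ₂ : ℝ}
    (h1 : ∀ μ, ‖((V μ x : 𝔸ˣ) : 𝔸) - 1‖ ≤ τ₁) (h1' : ∀ μ, ‖((V μ ((T μ).symm x) : 𝔸ˣ) : 𝔸) - 1‖ ≤ τ₁)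
    (h2 : ∀ μ, ‖((V μ x : 𝔸ˣ) : 𝔸) - (V μ ((T μ).symm x) : 𝔸ˣ)‖ ≤ τ₂) :
    ‖divB T V (fun μ => covD T V μ F) x - ∑ μ, ((F x - F (T μ x)) + (F x - F ((T μ).symm x)))‖
      ≤ ∑ μ, ((2 * τ₂ + 4 * τ₁ ^ 2) * ‖F x‖ + 2 * τ₁ * ‖F (T μ x) - F x‖ + 2 * τ₁ * ‖F ((T μ).symm x) - F x‖) := by
  rw [covLaplace_sub_flat, norm_neg]
  refine (norm_sum_le _ _).trans (Finset.sum_le_sum fun μ _ => ?_)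
  have hτ₁ : 0 ≤ τ₁ := (norm_nonneg _).trans (h1 μ)
  set h := V μ x with hh
  set h' := V μ ((T μ).symm x) with hh'
  set Z := F x
  set Zp := F (T μ x)
  set Zm := F ((T μ).symm x)
  -- regroup around `Z`: `R(h)Z₊ − Z₊ = (R(h)Z − Z) + (R(h)(Z₊−Z) − (Z₊−Z))`, likewise for `h′⁻¹`
  have e : (R h Zp - Zp) + (R h'⁻¹ Zm - Zm)
      = ((R h Z - Z) + (R h'⁻¹ Z - Z)) + (R h (Zp - Z) - (Zp - Z)) + (R h'⁻¹ (Zm - Z) - (Zm - Z)) := by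
    simp only [B9Eq39Adjoint.R_sub]; abel
  rw [e]
  have hinv : ‖(((h'⁻¹ : 𝔸ˣ)) : 𝔸) - 1‖ ≤ τ₁ := by
    have e1 : ((h'⁻¹ : 𝔸ˣ) : 𝔸) - 1 = ((h'⁻¹ : 𝔸ˣ) : 𝔸) * (1 - (h' : 𝔸)) := by rw [mul_sub, mul_one, Units.inv_mul]
    rw [e1]
    calc _ ≤ ‖((h'⁻¹ : 𝔸ˣ) : 𝔸)‖ * ‖1 - (h' : 𝔸)‖ := norm_mul_le _ _
      _ ≤ 1 * τ₁ := by gcongr; exacts [(hV μ _).2, by rw [norm_sub_rev]; exact h1' μ]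
      _ = τ₁ := one_mul _
  have nAB : ‖(R h Z - Z) + (R h'⁻¹ Z - Z)‖ ≤ (2 * τ₂ + 4 * τ₁ ^ 2) * ‖Z‖ :=
    norm_R_add_R_inv_sub_two_le (hV μ x) (hV μ ((T μ).symm x)) (h1 μ) (h1' μ) (h2 μ) Z
  have nA : ‖R h (Zp - Z) - (Zp - Z)‖ ≤ 2 * τ₁ * ‖Zp - Z‖ :=
    (norm_R_sub_self_le (hV μ x).2 _).trans (by gcongr; exact h1 μ)
  have nB : ‖R h'⁻¹ (Zm - Z) - (Zm - Z)‖ ≤ 2 * τ₁ * ‖Zm - Z‖ := by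
    have hb := norm_R_sub_self_le (bicontr_inv (hV μ ((T μ).symm x))).2 (Zm - Z)
    exact hb.trans (by gcongr)
  calc _ ≤ ‖(R h Z - Z) + (R h'⁻¹ Z - Z)‖ + ‖R h (Zp - Z) - (Zp - Z)‖ + ‖R h'⁻¹ (Zm - Z) - (Zm - Z)‖ := norm_add₃_le
    _ ≤ (2 * τ₂ + 4 * τ₁ ^ 2) * ‖Z‖ + 2 * τ₁ * ‖Zp - Z‖ + 2 * τ₁ * ‖Zm - Z‖ := add_le_add (add_le_add nAB nA) nB

end Compare

/-! ## §4 ★★★ The framed version -/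

section Framed

variable {𝔸 : Type} [NormedRing 𝔸] [NormedAlgebra ℝ 𝔸] {S : Type*} {ι : Type*} [Fintype ι] (T : ι → Equiv.Perm S) (U : ι → S → 𝔸ˣ) (Fr : S → 𝔸ˣ)

omit [NormedAlgebra ℝ 𝔸] in
/-- gauge covariance of `Δ_U` under a frame (from ✓p666119 `R_inv_frame_covD`, twice, summed). [cite: Balaban1985BackgroundPropagators, (3.28) p.395] -/
theorem R_inv_frame_covLaplace (e : S → 𝔸) (x : S) :
    R (Fr x)⁻¹ (divB T U (fun μ => covD T U μ e) x)
      = divB T (fun κ z => (Fr z)⁻¹ * U κ z * Fr (T κ z)) (fun μ => covD T (fun κ z => (Fr z)⁻¹ * U κ z * Fr (T κ z)) μ (fun z => R (Fr z)⁻¹ (e z))) x := by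
  have hy : ∀ μ, T μ ((T μ).symm x) = x := fun μ => Equiv.apply_symm_apply _ _
  -- both sides unfold to sums over `μ` of `covDstar`-terms; use `R_inv_frame_covD` on the inner `covD` and the group law on the outer transport
  simp only [divB, Prop7ConjFrameTransport.R_finset_sum]
  refine Finset.sum_congr rfl fun μ _ => ?_
  simp only [covDstar, B9Eq39Adjoint.R_sub]
  rw [R_inv_frame_covD T U Fr e μ x]
  congr 1
  rw [← B9Eq39Adjoint.R_mul, ← R_inv_frame_covD T U Fr e μ ((T μ).symm x), ← B9Eq39Adjoint.R_mul]
  congr 1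
  rw [hy]
  simp only [mul_inv_rev, inv_inv, mul_assoc, mul_inv_cancel, mul_one]

/-- ★★★ **THE COVARIANT LAPLACIAN OF A FRAME-TRANSPORTED «SCALAR × CONSTANT»**: with the framed links `h_μ(z) = Fr(z)⁻¹U_μ(z)Fr(T_μz)` obeying the size rows at `x` and `T_μ⁻¹x`
(`≤ τ₁`) and the longitudinal difference row (`≤ τ₂`): `‖Δ_U(z ↦ φ(z)•R(Fr z)Y)(x) − (Δφ)(x)•R(Fr x)Y‖ ≤ Σ_μ[(2τ₂+4τ₁²)|φ x| + 2τ₁|φ(T_μx) − φ x| + 2τ₁|φ(T_μ⁻¹x) − φ x|]·‖Y‖`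
(`U`, `Fr` bi-contractive). [cite: Balaban1985BackgroundPropagators, (3.28) p.395, (3.35) p.396] -/
theorem norm_covLaplace_framedConst_sub_le (hU : ∀ (κ : ι) (y : S), ‖(U κ y : 𝔸)‖ ≤ 1 ∧ ‖(((U κ y)⁻¹ : 𝔸ˣ) : 𝔸)‖ ≤ 1)
    (hFr : ∀ z : S, ‖(Fr z : 𝔸)‖ ≤ 1 ∧ ‖(((Fr z)⁻¹ : 𝔸ˣ) : 𝔸)‖ ≤ 1)
    (φ : S → ℝ) (Y : 𝔸) (x : S) {τ₁ τ₂ : ℝ}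
    (h1 : ∀ μ, ‖(((Fr x)⁻¹ * U μ x * Fr (T μ x) : 𝔸ˣ) : 𝔸) - 1‖ ≤ τ₁)
    (h1' : ∀ μ, ‖(((Fr ((T μ).symm x))⁻¹ * U μ ((T μ).symm x) * Fr (T μ ((T μ).symm x)) : 𝔸ˣ) : 𝔸) - 1‖ ≤ τ₁)
    (h2 : ∀ μ, ‖(((Fr x)⁻¹ * U μ x * Fr (T μ x) : 𝔸ˣ) : 𝔸) - (((Fr ((T μ).symm x))⁻¹ * U μ ((T μ).symm x) * Fr (T μ ((T μ).symm x)) : 𝔸ˣ) : 𝔸)‖ ≤ τ₂) :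
    ‖divB T U (fun μ => covD T U μ (fun z => φ z • R (Fr z) Y)) x - (∑ μ, (2 * φ x - φ (T μ x) - φ ((T μ).symm x))) • R (Fr x) Y‖
      ≤ ∑ μ, ((2 * τ₂ + 4 * τ₁ ^ 2) * |φ x| + 2 * τ₁ * |φ (T μ x) - φ x| + 2 * τ₁ * |φ ((T μ).symm x) - φ x|) * ‖Y‖ := by
  set h : ι → S → 𝔸ˣ := fun κ z => (Fr z)⁻¹ * U κ z * Fr (T κ z) with hh
  have hbc : ∀ (κ : ι) (y : S), ‖(h κ y : 𝔸)‖ ≤ 1 ∧ ‖(((h κ y)⁻¹ : 𝔸ˣ) : 𝔸)‖ ≤ 1 := fun κ y =>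
    bicontr_mul (bicontr_mul (bicontr_inv (hFr y)) (hU κ y)) (hFr (T κ y))
  -- in the frame the field is `φ•Y`
  have hv : (fun z => R (Fr z)⁻¹ ((fun z => φ z • R (Fr z) Y) z)) = fun z => φ z • Y := by
    funext z; simp only [B9Eq39Adjoint.R_smul, B9Eq39Adjoint.R_inv_R]
  have hcov := R_inv_frame_covLaplace T U Fr (fun z => φ z • R (Fr z) Y) x
  rw [hv] at hcov
  -- transport back: `X = R(Fr x)(R(Fr x)⁻¹ X)`
  have e : divB T U (fun μ => covD T U μ (fun z => φ z • R (Fr z) Y)) x - (∑ μ, (2 * φ x - φ (T μ x) - φ ((T μ).symm x))) • R (Fr x) Y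
      = R (Fr x) (divB T h (fun μ => covD T h μ (fun z => φ z • Y)) x - (∑ μ, (2 * φ x - φ (T μ x) - φ ((T μ).symm x))) • Y) := by
    rw [B9Eq39Adjoint.R_sub, B9Eq39Adjoint.R_smul, ← hcov, B9Eq39Adjoint.R_R_inv]
  rw [e]
  refine (norm_R_le (hFr x).1 (hFr x).2 _).trans ?_
  exact norm_covLaplace_smul_const_sub_le T h hbc φ Y x h1 h1' h2

omit [Fintype ι] in
/-- ★★ **FIRST ORDER, FRAMED**: `‖D_U(z ↦ φ(z)•R(Fr z)Y)(x) − (φ(T_μx) − φ x)•R(Fr x)Y‖ ≤ 2‖h_μ(x) − 1‖·|φ(T_μx)|·‖Y‖` with the framed link `h_μ(x) = Fr(x)⁻¹U_μ(x)Fr(T_μx)`.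
[cite: Balaban1985BackgroundPropagators, (3.3) p.390, (3.28) p.395] -/
theorem norm_covD_framedConst_sub_le (hU : ∀ (κ : ι) (y : S), ‖(U κ y : 𝔸)‖ ≤ 1 ∧ ‖(((U κ y)⁻¹ : 𝔸ˣ) : 𝔸)‖ ≤ 1)
    (hFr : ∀ z : S, ‖(Fr z : 𝔸)‖ ≤ 1 ∧ ‖(((Fr z)⁻¹ : 𝔸ˣ) : 𝔸)‖ ≤ 1)
    (φ : S → ℝ) (Y : 𝔸) (μ : ι) (x : S) :
    ‖covD T U μ (fun z => φ z • R (Fr z) Y) x - (φ (T μ x) - φ x) • R (Fr x) Y‖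
      ≤ 2 * ‖(((Fr x)⁻¹ * U μ x * Fr (T μ x) : 𝔸ˣ) : 𝔸) - 1‖ * (|φ (T μ x)| * ‖Y‖) := by
  set h : ι → S → 𝔸ˣ := fun κ z => (Fr z)⁻¹ * U κ z * Fr (T κ z) with hh
  have hbc : ∀ (κ : ι) (y : S), ‖(h κ y : 𝔸)‖ ≤ 1 ∧ ‖(((h κ y)⁻¹ : 𝔸ˣ) : 𝔸)‖ ≤ 1 := fun κ y =>
    bicontr_mul (bicontr_mul (bicontr_inv (hFr y)) (hU κ y)) (hFr (T κ y))
  have hv : (fun z => R (Fr z)⁻¹ ((fun z => φ z • R (Fr z) Y) z)) = fun z => φ z • Y := by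
    funext z; simp only [B9Eq39Adjoint.R_smul, B9Eq39Adjoint.R_inv_R]
  have hcov := R_inv_frame_covD T U Fr (fun z => φ z • R (Fr z) Y) μ x
  rw [hv] at hcov
  have e : covD T U μ (fun z => φ z • R (Fr z) Y) x - (φ (T μ x) - φ x) • R (Fr x) Y
      = R (Fr x) (covD T h μ (fun z => φ z • Y) x - (φ (T μ x) - φ x) • Y) := by
    rw [B9Eq39Adjoint.R_sub, B9Eq39Adjoint.R_smul, ← hcov, B9Eq39Adjoint.R_R_inv]
  rw [e]
  refine (norm_R_le (hFr x).1 (hFr x).2 _).trans ?_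
  exact norm_covD_smul_const_sub_le T h hbc φ Y μ x

omit [NormedAlgebra ℝ 𝔸] in
/-- ★★★ **GENERAL FIELD, FRAMED**: `‖Δ_U(z ↦ R(Fr z)(F z))(x) − R(Fr x)(Δ_flat F(x))‖ ≤ Σ_μ[(2τ₂+4τ₁²)‖F x‖ + 2τ₁‖F(T_μx) − F x‖ + 2τ₁‖F(T_μ⁻¹x) − F x‖]` with the framed links
`h_μ(z) = Fr(z)⁻¹U_μ(z)Fr(T_μz)` (size rows at `x`, `T_μ⁻¹x`; longitudinal difference row); the second transplant generation `F = G̃₂ ∗ J̃₁` reads this one.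
[cite: Balaban1985BackgroundPropagators, (3.28) p.395, (3.35) p.396] -/
theorem norm_covLaplace_framed_sub_flat_le (hU : ∀ (κ : ι) (y : S), ‖(U κ y : 𝔸)‖ ≤ 1 ∧ ‖(((U κ y)⁻¹ : 𝔸ˣ) : 𝔸)‖ ≤ 1)
    (hFr : ∀ z : S, ‖(Fr z : 𝔸)‖ ≤ 1 ∧ ‖(((Fr z)⁻¹ : 𝔸ˣ) : 𝔸)‖ ≤ 1)
    (F : S → 𝔸) (x : S) {τ₁ τ₂ : ℝ}
    (h1 : ∀ μ, ‖(((Fr x)⁻¹ * U μ x * Fr (T μ x) : 𝔸ˣ) : 𝔸) - 1‖ ≤ τ₁)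
    (h1' : ∀ μ, ‖(((Fr ((T μ).symm x))⁻¹ * U μ ((T μ).symm x) * Fr (T μ ((T μ).symm x)) : 𝔸ˣ) : 𝔸) - 1‖ ≤ τ₁)
    (h2 : ∀ μ, ‖(((Fr x)⁻¹ * U μ x * Fr (T μ x) : 𝔸ˣ) : 𝔸) - (((Fr ((T μ).symm x))⁻¹ * U μ ((T μ).symm x) * Fr (T μ ((T μ).symm x)) : 𝔸ˣ) : 𝔸)‖ ≤ τ₂) :
    ‖divB T U (fun μ => covD T U μ (fun z => R (Fr z) (F z))) x - R (Fr x) (∑ μ, ((F x - F (T μ x)) + (F x - F ((T μ).symm x))))‖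
      ≤ ∑ μ, ((2 * τ₂ + 4 * τ₁ ^ 2) * ‖F x‖ + 2 * τ₁ * ‖F (T μ x) - F x‖ + 2 * τ₁ * ‖F ((T μ).symm x) - F x‖) := by
  set h : ι → S → 𝔸ˣ := fun κ z => (Fr z)⁻¹ * U κ z * Fr (T κ z) with hh
  have hbc : ∀ (κ : ι) (y : S), ‖(h κ y : 𝔸)‖ ≤ 1 ∧ ‖(((h κ y)⁻¹ : 𝔸ˣ) : 𝔸)‖ ≤ 1 := fun κ y =>
    bicontr_mul (bicontr_mul (bicontr_inv (hFr y)) (hU κ y)) (hFr (T κ y))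
  have hv : (fun z => R (Fr z)⁻¹ ((fun z => R (Fr z) (F z)) z)) = F := by
    funext z; simp only [B9Eq39Adjoint.R_inv_R]
  have hcov := R_inv_frame_covLaplace T U Fr (fun z => R (Fr z) (F z)) x
  rw [hv] at hcov
  have e : divB T U (fun μ => covD T U μ (fun z => R (Fr z) (F z))) x - R (Fr x) (∑ μ, ((F x - F (T μ x)) + (F x - F ((T μ).symm x))))
      = R (Fr x) (divB T h (fun μ => covD T h μ F) x - ∑ μ, ((F x - F (T μ x)) + (F x - F ((T μ).symm x)))) := by
    rw [B9Eq39Adjoint.R_sub, ← hcov, B9Eq39Adjoint.R_R_inv]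
  rw [e]
  refine (norm_R_le (hFr x).1 (hFr x).2 _).trans ?_
  exact norm_covLaplace_sub_flat_le T h hbc F x h1 h1' h2

omit [Fintype ι] [NormedAlgebra ℝ 𝔸] in
/-- ★★ **FIRST ORDER, GENERAL FIELD, FRAMED**: `‖D_U(z ↦ R(Fr z)(F z))(x) − R(Fr x)(F(T_μx) − F x)‖ ≤ 2‖h_μ(x) − 1‖·‖F(T_μx)‖`. [cite: Balaban1985BackgroundPropagators, (3.3) p.390, (3.28) p.395] -/
theorem norm_covD_framed_sub_fdiff_le (hU : ∀ (κ : ι) (y : S), ‖(U κ y : 𝔸)‖ ≤ 1 ∧ ‖(((U κ y)⁻¹ : 𝔸ˣ) : 𝔸)‖ ≤ 1)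
    (hFr : ∀ z : S, ‖(Fr z : 𝔸)‖ ≤ 1 ∧ ‖(((Fr z)⁻¹ : 𝔸ˣ) : 𝔸)‖ ≤ 1)
    (F : S → 𝔸) (μ : ι) (x : S) :
    ‖covD T U μ (fun z => R (Fr z) (F z)) x - R (Fr x) (F (T μ x) - F x)‖
      ≤ 2 * ‖(((Fr x)⁻¹ * U μ x * Fr (T μ x) : 𝔸ˣ) : 𝔸) - 1‖ * ‖F (T μ x)‖ := by
  set h : ι → S → 𝔸ˣ := fun κ z => (Fr z)⁻¹ * U κ z * Fr (T κ z) with hh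
  have hbc : ∀ (κ : ι) (y : S), ‖(h κ y : 𝔸)‖ ≤ 1 ∧ ‖(((h κ y)⁻¹ : 𝔸ˣ) : 𝔸)‖ ≤ 1 := fun κ y =>
    bicontr_mul (bicontr_mul (bicontr_inv (hFr y)) (hU κ y)) (hFr (T κ y))
  have hv : (fun z => R (Fr z)⁻¹ ((fun z => R (Fr z) (F z)) z)) = F := by
    funext z; simp only [B9Eq39Adjoint.R_inv_R]
  have hcov := R_inv_frame_covD T U Fr (fun z => R (Fr z) (F z)) μ x
  rw [hv] at hcov
  have e : covD T U μ (fun z => R (Fr z) (F z)) x - R (Fr x) (F (T μ x) - F x) = R (Fr x) (covD T h μ F x - (F (T μ x) - F x)) := by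
    rw [B9Eq39Adjoint.R_sub (Fr x) (covD T h μ F x), ← hcov, B9Eq39Adjoint.R_R_inv]
  rw [e]
  refine (norm_R_le (hFr x).1 (hFr x).2 _).trans ?_
  exact Prop7FramedSecondDifference.norm_covD_sub_fdiff_le T h F μ x (hbc μ x).2

end Framed

end Summit.QuantumFields.YangMills.Theorems.Prop7FramedScalarMatrix

end
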